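import Mathlib

/-! Proof attempt of `GramPencilTangency` (card gram-pencil-tangency). -/

noncomputable section

namespace Summit.AtomisticToContinuum.BoseEinsteinCondensation.Cruxes.PeriodicIRBound.Ideator2

theorem gramPencilTangency_holds :
    ∀ A B n p : ℝ, 0 < B → B < A → 0 ≤ n →
    p ^ 2 ≤ n * (n + 1) →
    0 ≤ B * p - A * n →
    0 ≤ A * (n + 1) - B * p →
    (B / 2) ^ 2 ≤ (B * p - A * n) * (A * (n + 1) - B * p) →
    2 * n + 1 = A / Real.sqrt (A ^ 2 - B ^ 2) := by
  intro A B n p hB hBA hn hgram hd1 hd2 hdet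
  have hA : 0 < A := hB.trans hBA
  have hε2pos : 0 < A ^ 2 - B ^ 2 := by nlinarith
  set ε := Real.sqrt (A ^ 2 - B ^ 2) with hεdef
  have hεpos : 0 < ε := Real.sqrt_pos.mpr hε2pos
  have hεsq : ε ^ 2 = A ^ 2 - B ^ 2 := Real.sq_sqrt hε2pos.le
  have hεA : ε < A := by nlinarith [sq_nonneg B]
  -- s = 2n+1, u = A s - 2 B p
  set s := 2 * n + 1 with hs
  set u := A * s - 2 * B * p with hu
  have hs1 : 1 ≤ s := by simp [hs]; linarith
  -- determinant identity: (Bp - An)(A(n+1) - Bp) = (A^2 - u^2)/4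
  have hdet' : u ^ 2 ≤ A ^ 2 - B ^ 2 := by
    have : (B * p - A * n) * (A * (n + 1) - B * p) = (A ^ 2 - u ^ 2) / 4 := by
      simp only [hu, hs]; ring
    nlinarith [this, hdet]
  have hule : u ≤ ε := by
    have h1 : |u| ≤ ε := by
      rw [← Real.sqrt_sq_eq_abs]
      exact Real.sqrt_le_sqrt hdet'
    exact (le_abs_self u).trans h1
  -- Gram: (2Bp)^2 ≤ B^2 (s^2 - 1)
  have hgram' : (A * s - u) ^ 2 ≤ B ^ 2 * (s ^ 2 - 1) := by
    have h2 : A * s - u = 2 * B * p := by simp only [hu]; ring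
    rw [h2]
    have : s ^ 2 - 1 = 4 * (n * (n + 1)) := by simp only [hs]; ring
    rw [this]
    nlinarith [hgram, sq_nonneg B]
  -- key: ε² s² - 2 A s u + u² + B² ≤ 0 and it is ≥ (ε s - A)²
  have hkey : ε ^ 2 * s ^ 2 - 2 * A * s * u + u ^ 2 + B ^ 2 ≤ 0 := by nlinarith [hgram', hεsq]
  have hsq : (ε * s - A) ^ 2 ≤ 0 := by
    have hprod : 0 ≤ (ε - u) * (2 * A * s - (u + ε)) := by
      apply mul_nonneg
      · linarith
      · nlinarith
    nlinarith [hkey, hprod, hεsq]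
  have hzero : ε * s - A = 0 := by
    have := sq_nonneg (ε * s - A)
    exact pow_eq_zero_iff (n := 2) (by norm_num) |>.mp (le_antisymm hsq this)
  have : s = A / ε := by
    field_simp
    linarith
  simpa [hs] using this

end Summit.AtomisticToContinuum.BoseEinsteinCondensation.Cruxes.PeriodicIRBound.Ideator2

end
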